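import Literature.NumberTheory.EllipticCurves.HeegnerFamilyScalingProofs
import Literature.NumberTheory.EllipticCurves.HeegnerCharIdealEnvelopeProofs
import HarnessLib

/-!
# Scaling transfer for characteristic ideals of quotients `𝔖/ℋ`: `ℋ ⊆ a·ℳ ⟹ char(𝔖/ℋ) ⊆ (a)·char(𝔖/ℳ)`
# (module theory over `Λ = ℤ_p⟦T⟧`; proofs file)

Topic `NumberTheory/EllipticCurves`. THEOREMS ONLY (no definition, no named fact, no `sorry`), on the
vocabulary of `IwasawaAlgebra.lean` (`Module.charIdeal`), `HeegnerModuleIndex.lean` (`heegnerModule`,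
`heegnerCharIdeal`) and `CastellaGrossiLeeSkinner2022/HowardDivisibilityAnyClassNumber.lean`
(`stabilizedHeegnerModule`, `stabilizedHeegnerCharIdeal`). Written by the cell `bsd-print-x9` seat
`bsd-line-x9-p2` for crux stmt-BirchSwinnertonDyer-25235 `PrintX9.HowardContainmentLightFrameOfPrint`
(line `torsion-depth-light-ofprint`), as the ALGEBRA of the "scaling reduction" of the promotion step
"localized containment `(p^m)·I(Λκ_∞)² ⊆ char(𝒳_tors)` (CGLS 2022 Thm. 4.1.3 / Cor. 3.4.2) ⟹ integral
containment `I(ℋ_F)² ⊆ char(𝒳_tors)` for SOME tree Heegner family `F`": since `F` carries its own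
modular parametrisation and the tree rescales parametrisations (`ModularParametrizationData.zsmul`,
`HeegnerFamily.zsmul`; the sandwich `(C m)·ℋ_∞(F) ⊆ ℋ_∞(m•F) ⊆ ℋ_∞(F)` of
`HeegnerModuleScalingDivisibilityProofs`), the power `p^m` is absorbed as soon as
`ℋ_F ⊆ (p^m)·Λκ_∞` — and then one needs EXACTLY the inequality proved here. Companion of
`HeegnerCharIdealEnvelopeProofs` (`char(S/H) ⊆ char(S/H')` for `H ⊆ H'`), which is the case `a = 1`.

WHAT.
* `Module.exists_torsionFree_of_finrank_eq_one`, `Module.isTorsion_quotient_span_singleton_of_torsionFree_of_finrank_eq_one`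
  — bookkeeping over a domain: a module of `finrank 1` has a torsion-free element, and the quotient by
  the span of any torsion-free element is torsion (rank–nullity, `rank_quotient_add_rank_of_isDomain`).
* `Module.charIdeal_quotient_le_span_mul_of_le_smul` — **the transfer**: `S` finitely generated over
  `Λ`, submodules `N ≤ a • M` (`a ≠ 0`), `S ⧸ N` torsion, and `M` containing a torsion-free `z` with
  `S ⧸ Λz` torsion: `char(S ⧸ N) ≤ (a) · char(S ⧸ M)`. Proof by multiplicativity
  (`Module.charIdeal_eq_mul_of_exact`) along `S/Λ(az) ↠ S/aM`, `S/Λz ↠ S/M`, the cyclic case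
  `char(S/Λ(az)) = (a)·char(S/Λz)` (`Module.charIdeal_quotient_span_smul_eq`), the surjection
  "multiplication by `a`" from `ker(S/Λz ↠ S/M) = M/Λz` onto `ker(S/Λ(az) ↠ S/aM) = aM/Λ(az)`, and
  cancellation of the (principal, non-zero) characteristic ideal of the latter
  (`charIdeal_isPrincipal_holds`, `Ideal.span_singleton_mul_right_inj`). No torsion-freeness of `S` is
  needed (the `a`-torsion of `M` only shrinks `aM/Λ(az)`, which helps).
* `heegnerCharIdeal_le_span_pow_mul_stabilizedHeegnerCharIdeal_of_le_smul` — the specialisation the line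
  consumes: for `𝔖 = D.S` finitely generated of `finrank 1` (CGLS Thm. 4.1.3: "`H¹_{𝓕_Λ}(K,𝐓)` has
  `Λ`-rank one"), `ℋ_F ⊆ (p^m) • Λκ_C` and `𝔖/ℋ_F` torsion:
  `heegnerCharIdeal D F ≤ (p^m) · stabilizedHeegnerCharIdeal D C`.

HONEST FRAMING: pure algebra plus one specialisation; nothing about elliptic curves is asserted; the
inclusion `ℋ_F ⊆ (p^m)·Λκ_C` (distribution relations + universal norms + levelwise `p`-divisibility) is
a HYPOTHESIS here; BSD is not proved by any of this.

References: [NeukirchSchmidtWingberg2008] Ch. V §3 (multiplicativity of characteristic ideals);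
[Washington1997] §13.2 (`char(Λ/(f)) = (f)`, `Λ` a UFD); [BourbakiAC5to7] Ch. VII §4.5 Prop. 10;
[CastellaGrossiLeeSkinner2022] Thm. 4.1.3, Cor. 3.4.2, Rem. 4.1.4 (the `p^m` and `Λκ_∞`);
[Howard2004HeegnerKolyvagin] §1 ("Fixing a modular parametrization"), Thm. B.
-/

set_option autoImplicit false

noncomputable section

open scoped Classical Pointwise

namespace Literature.NumberTheory.EllipticCurves

/-! ## §1 Bookkeeping over a domain: torsion-free elements and rank one -/

namespace Module

variable {p : ℕ} [Fact p.Prime]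

/-- A finitely generated `Λ`-module of `finrank 1` has a torsion-free element (its rank is non-zero, so
it is not torsion, `rank_eq_zero_iff_isTorsion`).
[cite: BourbakiAC5to7, Ch. VII §4 no. 1 (rank over a domain; a module is torsion iff its rank is 0)] -/
theorem exists_torsionFree_of_finrank_eq_one {S : Type*} [AddCommGroup S]
    [_root_.Module (IwasawaAlgebra p) S] [Module.Finite (IwasawaAlgebra p) S]
    (hS1 : Module.finrank (IwasawaAlgebra p) S = 1) :
    ∃ s : S, ∀ b : IwasawaAlgebra p, b • s = 0 → b = 0 := by
  have hS : Module.rank (IwasawaAlgebra p) S = 1 := by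
    rw [← Module.finrank_eq_rank, hS1, Nat.cast_one]
  have hnt : ¬ Module.IsTorsion (IwasawaAlgebra p) S := by
    rw [← rank_eq_zero_iff_isTorsion, hS]; exact one_ne_zero
  unfold Module.IsTorsion at hnt
  push Not at hnt
  obtain ⟨s, hs⟩ := hnt
  refine ⟨s, fun b hb ↦ ?_⟩
  by_contra hb0
  exact hs ⟨b, mem_nonZeroDivisors_of_ne_zero hb0⟩ hb

/-- In a `Λ`-module of `finrank 1`, the quotient by the span of a torsion-free element is torsion
(rank–nullity over the domain `Λ`: `rank (S/Λz) + rank Λz = 1` and `rank Λz ≥ 1`).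
[cite: BourbakiAC5to7, Ch. VII §4 no. 1 (additivity of the rank over a domain; torsion iff rank 0)] -/
theorem isTorsion_quotient_span_singleton_of_torsionFree_of_finrank_eq_one {S : Type*} [AddCommGroup S]
    [_root_.Module (IwasawaAlgebra p) S] [Module.Finite (IwasawaAlgebra p) S]
    (hS1 : Module.finrank (IwasawaAlgebra p) S = 1) {z : S}
    (hz : ∀ b : IwasawaAlgebra p, b • z = 0 → b = 0) :
    Module.IsTorsion (IwasawaAlgebra p) (S ⧸ Submodule.span (IwasawaAlgebra p) {z}) := by
  set L := Submodule.span (IwasawaAlgebra p) {z} with hL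
  have hli : LinearIndependent (IwasawaAlgebra p) (fun _ : Unit ↦ z) := by
    rw [Fintype.linearIndependent_iff]
    intro g hg i
    rw [Fintype.sum_unique, show default = i from Subsingleton.elim _ _] at hg
    exact hz _ hg
  have hk : (1 : Cardinal) ≤ Module.rank (IwasawaAlgebra p) L := by
    have h := rank_span hli
    rw [Set.range_const, Cardinal.mk_singleton] at h
    rw [hL, h]
  have hS : Module.rank (IwasawaAlgebra p) S = 1 := by
    rw [← Module.finrank_eq_rank, hS1, Nat.cast_one]
  have hsum := rank_quotient_add_rank_of_isDomain L
  have hq0 : Module.rank (IwasawaAlgebra p) (S ⧸ L) = 0 := by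
    by_contra hne
    have h1 : (1 : Cardinal) ≤ Module.rank (IwasawaAlgebra p) (S ⧸ L) :=
      Cardinal.one_le_iff_ne_zero.mpr hne
    have h2 : (1 : Cardinal) + 1 ≤ Module.rank (IwasawaAlgebra p) S := hsum ▸ add_le_add h1 hk
    rw [hS] at h2
    norm_num at h2
  exact rank_eq_zero_iff_isTorsion.mp hq0

/-- Cancellation of a characteristic ideal: `char(K) · I = char(K) · J ⟹ I = J` (`char(K)` is principal,
`charIdeal_isPrincipal_holds`, and non-zero, in the domain `Λ`). [cite: Washington1997, §13.2 (Λ is a UFD; characteristic ideals are principal)] -/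
theorem eq_of_charIdeal_mul_eq (K : Type*) [AddCommGroup K] [_root_.Module (IwasawaAlgebra p) K]
    {I J : Ideal (IwasawaAlgebra p)}
    (h : charIdeal (IwasawaAlgebra p) K * I = charIdeal (IwasawaAlgebra p) K * J) : I = J := by
  obtain ⟨g, hg⟩ := (charIdeal_isPrincipal_holds p K).principal
  rw [Ideal.submodule_span_eq] at hg
  have hg0 : g ≠ 0 := by
    intro h0
    apply charIdeal_ne_bot (IwasawaAlgebra p) K
    rw [hg, h0, Ideal.span_singleton_eq_bot]
  rw [hg] at h
  exact (Ideal.span_singleton_mul_right_inj hg0).mp h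

/-! ## §2 The transfer `N ≤ a • M ⟹ char(S/N) ≤ (a) · char(S/M)` -/

/-- **Scaling transfer for characteristic ideals of quotients.** Let `S` be a finitely generated
`Λ`-module, `a ∈ Λ` non-zero, `N, M ≤ S` submodules with `N ≤ a • M`, `S ⧸ N` torsion, and suppose `M`
contains a torsion-free `z` with `S ⧸ Λz` torsion (e.g. `S` of rank one). Then
`char(S ⧸ N) ≤ (a) · char(S ⧸ M)`. (With `L = Λz`: `char(S/Λ(az)) = (a)·char(S/L)` is the cyclic case;
`char(S/Λ(az)) = char(aM/Λ(az))·char(S/aM)` and `char(S/L) = char(M/L)·char(S/M)` by multiplicativity;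
multiplication by `a` maps `M/L` ONTO `aM/Λ(az)`, so `char(M/L) = char(ker)·char(aM/Λ(az))`; cancelling
`char(aM/Λ(az))` gives `char(S/aM) = (a)·char(ker)·char(S/M) ≤ (a)·char(S/M)`, and
`char(S/N) ≤ char(S/aM)` as `N ≤ aM`.) [cite: NeukirchSchmidtWingberg2008, Ch. V §3, Remark 2 after (5.3.9) (multiplicativity of characteristic ideals)]
[cite: Washington1997, §13.2 (char(Λ/(f)) = (f))] -/
theorem charIdeal_quotient_le_span_mul_of_le_smul {S : Type*} [AddCommGroup S]
    [_root_.Module (IwasawaAlgebra p) S] [Module.Finite (IwasawaAlgebra p) S]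
    {N M : Submodule (IwasawaAlgebra p) S} {a : IwasawaAlgebra p} (ha : a ≠ 0) (hN : N ≤ a • M)
    (htor : Module.IsTorsion (IwasawaAlgebra p) (S ⧸ N)) {z : S} (hzM : z ∈ M)
    (hz : ∀ b : IwasawaAlgebra p, b • z = 0 → b = 0)
    (htorL : Module.IsTorsion (IwasawaAlgebra p) (S ⧸ Submodule.span (IwasawaAlgebra p) {z})) :
    charIdeal (IwasawaAlgebra p) (S ⧸ N) ≤
      Ideal.span {a} * charIdeal (IwasawaAlgebra p) (S ⧸ M) := by
  haveI : IsNoetherian (IwasawaAlgebra p) S := isNoetherian_of_isNoetherianRing_of_finite _ _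
  set L := Submodule.span (IwasawaAlgebra p) {z} with hL
  set La := Submodule.span (IwasawaAlgebra p) {a • z} with hLa
  set Ma : Submodule (IwasawaAlgebra p) S := a • M with hMa
  -- the four inclusions
  have hMaM : Ma ≤ M := Submodule.smul_le_self_of_tower a M
  have hLM : L ≤ M := by rw [hL, Submodule.span_singleton_le_iff_mem]; exact hzM
  have hLaMa : La ≤ Ma := by
    rw [hLa, Submodule.span_singleton_le_iff_mem]
    exact Submodule.smul_mem_pointwise_smul _ _ _ hzM
  have hLaL : La ≤ L := by
    rw [hLa, Submodule.span_singleton_le_iff_mem]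
    exact Submodule.smul_mem _ a (Submodule.mem_span_singleton_self z)
  -- torsion of the quotients involved
  have htorMa : Module.IsTorsion (IwasawaAlgebra p) (S ⧸ Ma) := fun x ↦ by
    obtain ⟨s, rfl⟩ := Submodule.Quotient.mk_surjective _ x
    obtain ⟨⟨b, hb⟩, hbs⟩ := @htor (Submodule.Quotient.mk s)
    refine ⟨⟨b, hb⟩, ?_⟩
    rw [Submonoid.mk_smul, ← Submodule.Quotient.mk_smul, Submodule.Quotient.mk_eq_zero] at hbs ⊢
    exact hN hbs
  have htorLa : Module.IsTorsion (IwasawaAlgebra p) (S ⧸ La) := fun x ↦ by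
    obtain ⟨s, rfl⟩ := Submodule.Quotient.mk_surjective _ x
    obtain ⟨⟨b, hb⟩, hbs⟩ := @htorL (Submodule.Quotient.mk s)
    rw [Submonoid.mk_smul, ← Submodule.Quotient.mk_smul, Submodule.Quotient.mk_eq_zero, hL,
      Submodule.mem_span_singleton] at hbs
    obtain ⟨c, hc⟩ := hbs
    refine ⟨⟨a * b, mul_mem (mem_nonZeroDivisors_of_ne_zero ha) hb⟩, ?_⟩
    rw [Submonoid.mk_smul, ← Submodule.Quotient.mk_smul, Submodule.Quotient.mk_eq_zero, hLa,
      Submodule.mem_span_singleton, mul_smul, ← hc, smul_comm]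
    exact ⟨c, rfl⟩
  -- (i) `char(S/La) = char(K₁)·char(S/Ma)`, `K₁ = ker(S/La ↠ S/Ma)`
  set g₁ : (S ⧸ La) →ₗ[IwasawaAlgebra p] (S ⧸ Ma) := Submodule.factor hLaMa with hg₁
  set K₁ := LinearMap.ker g₁ with hK₁
  have e₁ := charIdeal_eq_mul_of_exact (R := IwasawaAlgebra p) htorLa K₁.subtype g₁
    (Submodule.injective_subtype _) (Submodule.factor_surjective hLaMa) (LinearMap.exact_subtype_ker_map _)
  -- (ii) `char(S/L) = char(K₂)·char(S/M)`, `K₂ = ker(S/L ↠ S/M)`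
  set g₂ : (S ⧸ L) →ₗ[IwasawaAlgebra p] (S ⧸ M) := Submodule.factor hLM with hg₂
  set K₂ := LinearMap.ker g₂ with hK₂
  have e₂ := charIdeal_eq_mul_of_exact (R := IwasawaAlgebra p) htorL K₂.subtype g₂
    (Submodule.injective_subtype _) (Submodule.factor_surjective hLM) (LinearMap.exact_subtype_ker_map _)
  -- (iii) the cyclic case `char(S/La) = (a)·char(S/L)`
  have e₃ := charIdeal_quotient_span_smul_eq (S := S) hz htorL ha
  -- (iv) multiplication by `a`: `K₂ ↠ K₁`
  let ψ₀ : (S ⧸ L) →ₗ[IwasawaAlgebra p] (S ⧸ La) :=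
    Submodule.mapQ L La (a • LinearMap.id) (by
      intro x hx
      rw [hL, Submodule.mem_span_singleton] at hx
      obtain ⟨c, rfl⟩ := hx
      show a • (c • z) ∈ La
      rw [smul_comm, hLa]
      exact Submodule.smul_mem _ c (Submodule.mem_span_singleton_self _))
  have hψ₀ : ∀ s : S, ψ₀ (Submodule.Quotient.mk s) = Submodule.Quotient.mk (a • s) := fun s ↦
    Submodule.mapQ_apply _ _ _ s
  have hmemK₁ : ∀ s : S, (Submodule.Quotient.mk s : S ⧸ La) ∈ K₁ ↔ s ∈ Ma := fun s ↦ by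
    rw [hK₁, LinearMap.mem_ker, show g₁ (Submodule.Quotient.mk s) = (Submodule.Quotient.mk s : S ⧸ Ma)
      from rfl, Submodule.Quotient.mk_eq_zero]
  have hmemK₂ : ∀ s : S, (Submodule.Quotient.mk s : S ⧸ L) ∈ K₂ ↔ s ∈ M := fun s ↦ by
    rw [hK₂, LinearMap.mem_ker, show g₂ (Submodule.Quotient.mk s) = (Submodule.Quotient.mk s : S ⧸ M)
      from rfl, Submodule.Quotient.mk_eq_zero]
  have hmaps : ∀ x : K₂, ψ₀ (x : S ⧸ L) ∈ K₁ := by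
    rintro ⟨x, hx⟩
    obtain ⟨s, rfl⟩ := Submodule.Quotient.mk_surjective _ x
    rw [hψ₀, hmemK₁]
    exact Submodule.smul_mem_pointwise_smul _ _ _ ((hmemK₂ s).mp hx)
  let ψ : K₂ →ₗ[IwasawaAlgebra p] K₁ := LinearMap.codRestrict K₁ (ψ₀.comp K₂.subtype) hmaps
  have hψsurj : Function.Surjective ψ := by
    rintro ⟨y, hy⟩
    obtain ⟨s, rfl⟩ := Submodule.Quotient.mk_surjective _ y
    obtain ⟨t, ht, rfl⟩ := (Submodule.mem_smul_pointwise_iff_exists _ _ _).mp ((hmemK₁ _).mp hy)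
    refine ⟨⟨Submodule.Quotient.mk t, (hmemK₂ t).mpr ht⟩, ?_⟩
    apply Subtype.ext
    show ψ₀ (Submodule.Quotient.mk t) = Submodule.Quotient.mk (a • t)
    exact hψ₀ t
  have htorK₂ : Module.IsTorsion (IwasawaAlgebra p) K₂ := fun x ↦ by
    obtain ⟨b, hb⟩ := @htorL (x : S ⧸ L)
    exact ⟨b, Subtype.ext (by rw [Submonoid.smul_def, Submodule.coe_smul, ZeroMemClass.coe_zero]; exact hb)⟩
  haveI : Module.Finite (IwasawaAlgebra p) K₂ := Module.IsNoetherian.finite _ _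
  clear_value ψ
  set K₃ := LinearMap.ker ψ with hK₃
  have hexact : Function.Exact K₃.subtype ψ := by
    rw [hK₃]; exact LinearMap.exact_subtype_ker_map ψ
  have e₄ : charIdeal (IwasawaAlgebra p) K₂ =
      charIdeal (IwasawaAlgebra p) K₃ * charIdeal (IwasawaAlgebra p) K₁ :=
    charIdeal_eq_mul_of_exact (R := IwasawaAlgebra p) (M' := K₃) (M := K₂) (M'' := K₁) htorK₂
      K₃.subtype ψ (Submodule.injective_subtype _) hψsurj hexact
  -- cancel `char(K₁)`
  have key : charIdeal (IwasawaAlgebra p) K₁ * charIdeal (IwasawaAlgebra p) (S ⧸ Ma) =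
      charIdeal (IwasawaAlgebra p) K₁ * (Ideal.span {a} *
        charIdeal (IwasawaAlgebra p) K₃ * charIdeal (IwasawaAlgebra p) (S ⧸ M)) := by
    rw [← e₁, e₃, e₂, e₄]; ring
  have hMa_eq := eq_of_charIdeal_mul_eq (p := p) K₁ key
  calc charIdeal (IwasawaAlgebra p) (S ⧸ N)
      ≤ charIdeal (IwasawaAlgebra p) (S ⧸ Ma) := charIdeal_quotient_le_of_le hN htor
    _ = Ideal.span {a} * charIdeal (IwasawaAlgebra p) K₃ *
          charIdeal (IwasawaAlgebra p) (S ⧸ M) := hMa_eq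
    _ ≤ Ideal.span {a} * charIdeal (IwasawaAlgebra p) (S ⧸ M) :=
        Ideal.mul_mono_left Ideal.mul_le_right

end Module

/-! ## §3 The specialisation the line consumes: `ℋ_F ⊆ (p^m)·Λκ_C ⟹ I(ℋ_F) ⊆ (p^m)·I(Λκ_C)` -/

section Heegner

open WeierstrassCurve CastellaGrossiLeeSkinner2022

universe u

variable {K : Type u} [Field K] [NumberField K] {N : ℕ} [NeZero N] {W : WeierstrassCurve ℚ}
  [W.IsGloballyMinimal] {p : ℕ} [Fact p.Prime] {κ : ZpExtension K p} {γ : Field.absoluteGaloisGroup K}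
  {jbar : AlgebraicClosure K →+* ℂ}

/-- **`ℋ_F ⊆ (p^m)·Λκ_C ⟹ I(ℋ_F) ⊆ (p^m)·I(Λκ_C)`**: for a `Λ`-adic Selmer datum `D` with `𝔖 = D.S`
finitely generated of `finrank 1` (CGLS 2022 Thm. 4.1.3: "`H¹_{𝓕_Λ}(K,𝐓)` has `Λ`-rank one"), a tree
Heegner family `F` with `𝔖/ℋ_F` torsion, and a stabilised datum `C`, if `heegnerModule D F` lies in
`(p^m) • stabilizedHeegnerModule D C` then `heegnerCharIdeal D F ≤ (p^m) · stabilizedHeegnerCharIdeal D C` —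
so that CGLS's `(p^m)·I(Λκ_C)² ⊆ char(𝒳_tors)` yields Howard's `I(ℋ_F)² ⊆ char(𝒳_tors)` for such an `F`
(obtained by rescaling the parametrisation). The inclusion is a HYPOTHESIS here.
[cite: CastellaGrossiLeeSkinner2022, Thm. 4.1.3, Cor. 3.4.2 and Rem. 4.1.4 (the p^m and Λκ_∞)]
[cite: Howard2004HeegnerKolyvagin, §1 ("Fixing a modular parametrization") and Thm. B] -/
theorem heegnerCharIdeal_le_span_pow_mul_stabilizedHeegnerCharIdeal_of_le_smul
    (D : (W.baseChange K).LambdaAdicSelmerData κ γ) [Module.Finite (IwasawaAlgebra p) D.S]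
    (hS1 : Module.finrank (IwasawaAlgebra p) D.S = 1) (F : HeegnerFamily N W K κ jbar)
    (C : StabilizedHeegnerData N W K κ jbar) (m : ℕ)
    (hle : heegnerModule D F ≤ ((p : IwasawaAlgebra p) ^ m) • stabilizedHeegnerModule D C)
    (htor : Module.IsTorsion (IwasawaAlgebra p) (D.S ⧸ heegnerModule D F)) :
    heegnerCharIdeal D F ≤
      Ideal.span {(p : IwasawaAlgebra p) ^ m} * stabilizedHeegnerCharIdeal D C := by
  -- `p^m ≠ 0` in the domain `Λ`
  have hp0 : (p : IwasawaAlgebra p) ≠ 0 := by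
    rw [← map_natCast (PowerSeries.C (R := ℤ_[p])) p]
    exact (map_ne_zero_iff _ PowerSeries.C_injective).mpr (Nat.cast_ne_zero.mpr (Fact.out : p.Prime).ne_zero)
  have ha : (p : IwasawaAlgebra p) ^ m ≠ 0 := pow_ne_zero _ hp0
  -- a torsion-free element of `𝔖` and a non-zero multiple of it inside `ℋ_F ⊆ Λκ_C`
  obtain ⟨s₀, hs₀⟩ := Module.exists_torsionFree_of_finrank_eq_one (p := p) hS1
  obtain ⟨⟨b, hb⟩, hbs⟩ := @htor (Submodule.Quotient.mk s₀)
  rw [Submonoid.mk_smul, ← Submodule.Quotient.mk_smul, Submodule.Quotient.mk_eq_zero] at hbs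
  have hb0 : b ≠ 0 := nonZeroDivisors.ne_zero hb
  have hzM : b • s₀ ∈ stabilizedHeegnerModule D C :=
    Submodule.smul_le_self_of_tower ((p : IwasawaAlgebra p) ^ m) _ (hle hbs)
  have hz : ∀ c : IwasawaAlgebra p, c • (b • s₀) = 0 → c = 0 := fun c hc ↦ by
    rw [smul_smul] at hc
    exact (mul_eq_zero.mp (hs₀ _ hc)).resolve_right hb0
  exact Module.charIdeal_quotient_le_span_mul_of_le_smul ha hle htor hzM hz
    (Module.isTorsion_quotient_span_singleton_of_torsionFree_of_finrank_eq_one hS1 hz)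

end Heegner

end Literature.NumberTheory.EllipticCurves

end
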